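import Mathlib
import Literature.NumberTheory.Transcendental.ZagierDilogarithmConjecture
import Literature.NumberTheory.Transcendental.PreBlochGroup
import Literature.NumberTheory.Transcendental.PreBlochHalf
import Literature.NumberTheory.Transcendental.PreBlochThreeSmooth
import Summits.KontsevichZagierPeriods.KontsevichZagierPeriods.Theorems.HyperbolicBlochZagierDilogarithmConjectureStubTwoSaturation
import HarnessLib

/-!
# `ZagierDilogarithmConjecture` (stmt-KontsevichZagierPeriods-10550) — line
`kummer-clausen-linearisation`, stub `stub_saturation`

**Saturation of the dilogarithm relator group.** If `n • x` (`n ≥ 1`) lies in the subgroup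
`C = ⟨dilogRelators⟩` of `ℤ[ℂ]` (five-term elements with algebraic entries, `[w] + [w̄]` for
algebraic `w`, `[r]` for real `r`), then so does `x` — the "`ℤ`-form ⇔ `ℚ`-form" bridge of
Zagier's conjecture (Neumann 1998, remark after Thm. 2.10 [Neumann1998]) — PROVIDED multiplication
by `n` is injective on the pre-Bloch group `P(K)` of the algebraically closed field
`K = ℚ̄ = algebraicClosure ℚ ℂ` (`saturation_of_nsmul_injective`). Two instances:

* `stub_saturation`: every `n ≥ 1`, conditional on the named fact
  `Suslin1991_preBloch_isUniquelyDivisible` (Dupont 2001, Thm. 8.16 [Dupont2001], after Suslin);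
* `saturation_of_primeFactors_le_three`: UNCONDITIONAL for every `n = 2ᵃ3ᵇ`, from the tree's
  proved `PreBloch.nsmul_bijective_of_primeFactors_le_three`.

Proof: verbatim the landed case `n = 2` (`stub_twoSaturation`, file
`HyperbolicBlochZagierDilogarithmConjectureStubTwoSaturation.lean`, whose lemmas are reused), the
only new input being `saturated_of_fixed`: a subgroup `N ≤ P(F)` fixed pointwise by an
endomorphism `c` and containing all `⟦z⟧ + c ⟦z⟧` contains every `y` with `n • y ∈ N` as soon as
`n • (·)` is injective on `P(F)` (`c y = y`; halve `y = 2 y₂`, `c y₂ = y₂` by the proved absence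
of `2`-torsion, `y = y₂ + c y₂ ∈ N`).
-/

noncomputable section

open scoped ComplexConjugate
open Literature.NumberTheory.Transcendental
open FreeAbelianGroup (of lift_apply_of)

namespace Summit.KontsevichZagierPeriods.HyperbolicBloch.ZagierDilogarithm

/-- `ℤ[ℂ]` has no `n`-torsion for `n ≥ 1`. [folklore] -/
theorem eq_zero_of_nsmul_eq_zero {n : ℕ} (hn : 0 < n) {x : FreeAbelianGroup ℂ} (h : n • x = 0) :
    x = 0 := by
  have h2 := congrArg (FreeAbelianGroup.equivFinsupp ℂ) h
  rw [map_nsmul, map_zero] at h2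
  have h3 := (smul_eq_zero.1 h2).resolve_left hn.ne'
  exact (FreeAbelianGroup.equivFinsupp ℂ).injective (by rw [h3, map_zero])

/-- If an additive subgroup `N` of `P(F)` (`F` algebraically closed of characteristic `0`)
contains `⟦z⟧ + c ⟦z⟧` for every `z`, `c` an endomorphism of `P(F)`, then `N` contains every fixed
point of `c`: `y = 2 y₂` (divisibility, Dupont 2001 Cor. 8.15), `c y₂ = y₂` (no `2`-torsion,
Thm. 8.16 for `n = 2`), `y = y₂ + c y₂`. [cite: Dupont2001, Thm. 8.16] -/
theorem mem_of_fixed {F : Type*} [Field F] [IsAlgClosed F] [CharZero F]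
    (c : PreBloch F →+ PreBloch F) (N : AddSubgroup (PreBloch F))
    (hgen : ∀ z : F, PreBloch.sym z + c (PreBloch.sym z) ∈ N) (y : PreBloch F) (hcy : c y = y) :
    y ∈ N := by
  obtain ⟨y', rfl⟩ := PreBloch.nsmul_surjective (F := F) two_pos y
  simp only at hcy ⊢
  have hcy' : c y' = y' := PreBloch.two_nsmul_injective (F := F)
    (show 2 • c y' = 2 • y' by rw [← map_nsmul]; exact hcy)
  have key : ∀ ξ : FreeAbelianGroup (PreBloch.Gen F),
      PreBloch.proj ξ + c (PreBloch.proj ξ) ∈ N := by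
    intro ξ
    induction ξ using FreeAbelianGroup.induction_on with
    | zero => rw [map_zero, map_zero, add_zero]; exact zero_mem _
    | of g =>
      rw [PreBloch.proj_of, ← PreBloch.sym_of_ne]
      exact hgen g.val
    | neg g ih =>
      rw [map_neg, map_neg, ← neg_add]
      exact neg_mem ih
    | add u v hu hv =>
      rw [map_add, map_add, add_add_add_comm]
      exact add_mem hu hv
  obtain ⟨ξ, rfl⟩ := PreBloch.proj_surjective y'
  rw [two_nsmul]
  simpa only [hcy'] using key ξ

/-- If an additive subgroup `N` of `P(F)` (`F` algebraically closed of characteristic `0`) is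
fixed pointwise by an endomorphism `c`, contains `⟦z⟧ + c ⟦z⟧` for every `z`, and `n • (·)` is
injective on `P(F)`, then `N` is `n`-saturated: `n • y ∈ N → y ∈ N` (`n (c y) = c (n y) = n y`, so
`c y = y`). [cite: Dupont2001, Thm. 8.16] -/
theorem saturated_of_fixed {F : Type*} [Field F] [IsAlgClosed F] [CharZero F]
    (c : PreBloch F →+ PreBloch F) (N : AddSubgroup (PreBloch F)) (hfix : ∀ m ∈ N, c m = m)
    (hgen : ∀ z : F, PreBloch.sym z + c (PreBloch.sym z) ∈ N) {n : ℕ}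
    (hinj : Function.Injective fun a : PreBloch F => n • a) (y : PreBloch F) (hy : n • y ∈ N) :
    y ∈ N :=
  mem_of_fixed c N hgen y (hinj (show n • c y = n • y by rw [← map_nsmul]; exact hfix _ hy))

/-- **Saturation of the dilogarithm relator group from the absence of `n`-torsion in `P(ℚ̄)`**:
if `n ≥ 1`, `n • (·)` is injective on `P(F)` for every algebraically closed field `F` of
characteristic `0` (in `Type`; used for `F = ℚ̄ ⊆ ℂ`), and `n • x ∈ ⟨dilogRelators⟩ ⊆ ℤ[ℂ]`, then
`x ∈ ⟨dilogRelators⟩`. The proof of the case `n = 2` (`stub_twoSaturation`) verbatim: support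
split (§1), the symbol map `Φ : ℤ[ℂ] → P(ℚ̄)` sends `⟨dilogRelators⟩` onto the conjugation-fixed,
`n`-saturated image `N` of the symmetric relators (§2), and `ker Φ|_{ℤ[ℚ̄]}` comes from five-term
dilogarithm relators (§3) (Neumann 1998, remark after Thm. 2.10: `ℤ`-form ⇔ `ℚ`-form).
[cite: Neumann1998, Thm. 2.10] -/
theorem saturation_of_nsmul_injective {n : ℕ} (hn : 0 < n)
    (hinj : ∀ (F : Type) [Field F] [IsAlgClosed F] [CharZero F],
      Function.Injective fun a : PreBloch F => n • a)
    (x : FreeAbelianGroup ℂ) (hx : n • x ∈ AddSubgroup.closure dilogRelators) :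
    x ∈ AddSubgroup.closure dilogRelators := by
  classical
  -- the algebraically closed field `K = ℚ̄ ⊆ ℂ` of algebraic numbers
  obtain ⟨K, hK0, hK⟩ : ∃ K : IntermediateField ℚ ℂ, IsAlgClosed K ∧ ∀ z, z ∈ K ↔ IsAlgebraic ℚ z :=
    ⟨algebraicClosure ℚ ℂ, (algebraicClosure.isAlgClosure ℚ ℂ).isAlgClosed,
      fun _ => mem_algebraicClosure_iff⟩
  have hKa : ∀ z, IsAlgebraic ℚ z → z ∈ K := fun z => (hK z).2
  have hKa' : ∀ z, z ∈ K → IsAlgebraic ℚ z := fun z => (hK z).1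
  have hKc : ∀ z, z ∈ K → conj z ∈ K :=
    fun z hz => hKa _ (by simpa using (hKa' z hz).algHom (starRingEnd ℂ).toRatAlgHom)
  -- §1: the support split
  let πA : FreeAbelianGroup ℂ →+ FreeAbelianGroup ℂ :=
    FreeAbelianGroup.lift fun z => if z ∈ K then of z else 0
  let πT : FreeAbelianGroup ℂ →+ FreeAbelianGroup ℂ :=
    FreeAbelianGroup.lift fun z => if z ∉ K ∧ z.im ≠ 0 then of z else 0
  have hA₁ : ∀ z, z ∈ K → πA (of z) = of z :=
    fun z hz => by simp only [πA, lift_apply_of, if_pos hz]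
  have hA₂ : ∀ z, z ∉ K → πA (of z) = 0 :=
    fun z hz => by simp only [πA, lift_apply_of, if_neg hz]
  have hTz : ∀ z, πT (of z) = if z ∉ K ∧ z.im ≠ 0 then of z else 0 :=
    fun z => lift_apply_of _ _
  have hT0 : πT x = 0 := by
    apply eq_zero_of_nsmul_eq_zero hn
    rw [← map_nsmul]
    exact (AddMonoidHom.mem_ker).1 (closure_le_ker_of_transcendental hKa hKc πT
      (fun z hz => by rw [hTz, if_neg fun h => h.1 hz])
      (fun z hz => by rw [hTz, if_neg fun h => h.2 hz]) hx)
  have hR : ∀ v, v - πA v - πT v ∈ AddSubgroup.closure dilogRelators := by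
    intro v
    induction v using FreeAbelianGroup.induction_on with
    | zero => simp only [map_zero, sub_zero]; exact zero_mem _
    | of z =>
      by_cases ha : z ∈ K
      · rw [hA₁ z ha, hTz, if_neg fun h => h.1 ha, sub_self, sub_zero]
        exact zero_mem _
      by_cases hr : z.im = 0
      · rw [hA₂ z ha, hTz, if_neg fun h => h.2 hr, sub_zero, sub_zero]
        exact AddSubgroup.subset_closure (of_real_mem_dilogRelators hr)
      · rw [hA₂ z ha, hTz, if_pos ⟨ha, hr⟩, sub_zero, sub_self]
        exact zero_mem _
    | neg z ih =>
      rw [map_neg, map_neg, ← neg_sub', ← neg_sub']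
      exact neg_mem ih
    | add u v hu hv =>
      rw [map_add, map_add, add_sub_add_comm, add_sub_add_comm]
      exact add_mem hu hv
  have hAC := closure_le_comap_of_algebraic hKa hKc πA hA₁ hA₂
  suffices hy : πA x ∈ AddSubgroup.closure dilogRelators by
    have h := add_mem (hR x) hy
    rwa [hT0, sub_zero, sub_add_cancel] at h
  -- §2: the pre-Bloch side
  haveI := hK0
  obtain ⟨σ, hσ⟩ := exists_conj_ringHom hKc
  obtain ⟨c, hc⟩ := exists_conj_preBloch σ
  let Φ : FreeAbelianGroup ℂ →+ PreBloch K :=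
    FreeAbelianGroup.lift fun z => if h : z ∈ K then PreBloch.sym (⟨z, h⟩ : K) else 0
  have hΦa : ∀ (z : ℂ) (h : z ∈ K), Φ (of z) = PreBloch.sym (⟨z, h⟩ : K) :=
    fun z h => by simp only [Φ, lift_apply_of, dif_pos h]
  have hΦt : ∀ z, z ∉ K → Φ (of z) = 0 :=
    fun z h => by simp only [Φ, lift_apply_of, dif_neg h]
  set SN : Set (FreeAbelianGroup ℂ) := {c : FreeAbelianGroup ℂ | ∃ w : ℂ, w ∈ K ∧
      c = of w + of (conj w)} ∪ {c | ∃ w : ℂ, w ∈ K ∧ w.im = 0 ∧ c = of w} with hSN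
  set N : AddSubgroup (PreBloch K) := (AddSubgroup.closure SN).map Φ with hN
  have hSN_le : AddSubgroup.closure SN ≤ AddSubgroup.closure dilogRelators := by
    apply AddSubgroup.closure_mono
    rintro r (⟨w, hw, rfl⟩ | ⟨w, -, hw, rfl⟩)
    · exact of_add_of_conj_mem_dilogRelators (hKa' w hw)
    · exact of_real_mem_dilogRelators hw
  have hfix : N ≤ c.eqLocus (AddMonoidHom.id _) := by
    rw [hN, AddMonoidHom.map_closure, AddSubgroup.closure_le]
    rintro _ ⟨r, (⟨w, hw, rfl⟩ | ⟨w, hw, hwim, rfl⟩), rfl⟩ <;> show c _ = _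
    · rw [map_add, hΦa w hw, hΦa _ (hKc w hw), map_add, hc, hc, add_comm]
      congr 2
      · exact Subtype.ext (by rw [hσ]; exact Complex.conj_conj w)
      · exact Subtype.ext (by rw [hσ])
    · rw [hΦa w hw, hc]
      exact congrArg _ (Subtype.ext (by rw [hσ]; exact Complex.conj_eq_iff_im.2 hwim))
  have hgen : ∀ z : K, PreBloch.sym z + c (PreBloch.sym z) ∈ N := by
    intro z
    have e1 : Φ (of (z : ℂ)) = PreBloch.sym z := hΦa _ z.2
    have e2 : Φ (of (conj (z : ℂ))) = PreBloch.sym (σ z) := by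
      rw [hΦa _ (hKc _ z.2)]
      exact congrArg _ (Subtype.ext (by rw [hσ]))
    rw [hc, ← e1, ← e2, ← map_add]
    exact AddSubgroup.mem_map_of_mem Φ (AddSubgroup.subset_closure (Or.inl ⟨z, z.2, rfl⟩))
  have hΦx : Φ x ∈ N := by
    apply saturated_of_fixed c N (fun m hm => hfix hm) hgen (hinj K)
    rw [← map_nsmul]
    exact closure_le_comap_sym hKa Φ hΦa hΦt hx
  -- §3: back to `ℤ[ℂ]`
  obtain ⟨m, hm, hmx⟩ := AddSubgroup.mem_map.1 hΦx
  let lam : FreeAbelianGroup ℂ →+ FreeAbelianGroup (PreBloch.Gen K) :=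
    FreeAbelianGroup.lift fun z => if h : z ∈ K ∧ z ≠ 0 ∧ z ≠ 1 then
      of (⟨⟨z, h.1⟩, coe_ne_zero_one h⟩ : PreBloch.Gen K) else 0
  have hl₁ : ∀ z : ℂ, z ∈ K ∧ z ≠ 0 ∧ z ≠ 1 →
      ∃ g : PreBloch.Gen K, (g.val : ℂ) = z ∧ lam (of z) = of g :=
    fun z h => ⟨⟨⟨z, h.1⟩, coe_ne_zero_one h⟩, rfl, by simp only [lam, lift_apply_of, dif_pos h]⟩
  have hl₂ : ∀ z : ℂ, ¬(z ∈ K ∧ z ≠ 0 ∧ z ≠ 1) → lam (of z) = 0 :=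
    fun z h => by simp only [lam, lift_apply_of, dif_neg h]
  let ι : FreeAbelianGroup (PreBloch.Gen K) →+ FreeAbelianGroup ℂ :=
    FreeAbelianGroup.lift fun g => of (g.val : ℂ)
  have hι : ∀ g, ι (of g) = of (g.val : ℂ) := fun g => lift_apply_of _ _
  obtain ⟨hu₁, hu₂⟩ := lambda_facts Φ hΦa hΦt πA hA₁ hA₂ lam hl₁ hl₂ ι hι (x - m)
  rw [map_sub, hmx, sub_self, eq_comm, PreBloch.proj_eq_zero_iff] at hu₁
  have h3 := add_mem hu₂ (closure_fiveTerm_le_comap hKa' ι hι hu₁)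
  rw [sub_add_cancel, map_sub] at h3
  have h4 := add_mem h3 (hAC (hSN_le hm))
  rwa [sub_add_cancel] at h4

/-- **Saturation of the dilogarithm relator group** (stub `stub_saturation` of line
`kummer-clausen-linearisation`): under Suslin's unique divisibility of the pre-Bloch group of
algebraically closed fields of characteristic `0` (Dupont 2001, Thm. 8.16),
`n • x ∈ ⟨dilogRelators⟩` (`n ≥ 1`) implies `x ∈ ⟨dilogRelators⟩` — the "`ℤ`-form ⇔ `ℚ`-form"
bridge of Zagier's conjecture (Neumann 1998, remark after Thm. 2.10).
[cite: Dupont2001, Thm. 8.16] -/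
theorem stub_saturation :
    Suslin1991_preBloch_isUniquelyDivisible →
      ∀ n : ℕ, 0 < n → ∀ x : FreeAbelianGroup ℂ, n • x ∈ AddSubgroup.closure dilogRelators →
        x ∈ AddSubgroup.closure dilogRelators :=
  fun h _n hn x hx => saturation_of_nsmul_injective hn (fun F _ _ _ => (h F _ hn).1) x hx

/-- **Unconditional saturation by `n = 2ᵃ3ᵇ`**: if all prime factors of `n ≥ 1` are `≤ 3` and
`n • x ∈ ⟨dilogRelators⟩`, then `x ∈ ⟨dilogRelators⟩` — from the tree's proved unique divisibility
of `P(ℚ̄)` by `2` and `3` (`PreBloch.nsmul_bijective_of_primeFactors_le_three`, the proved part of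
Dupont 2001, Thm. 8.16). [cite: Dupont2001, Thm. 8.16] -/
theorem saturation_of_primeFactors_le_three :
    ∀ n : ℕ, 0 < n → (∀ p : ℕ, p.Prime → p ∣ n → p ≤ 3) →
      ∀ x : FreeAbelianGroup ℂ, n • x ∈ AddSubgroup.closure dilogRelators →
        x ∈ AddSubgroup.closure dilogRelators :=
  fun _n hn h3 x hx => saturation_of_nsmul_injective hn
    (fun F _ _ _ => (PreBloch.nsmul_bijective_of_primeFactors_le_three (F := F) hn h3).1) x hx

end Summit.KontsevichZagierPeriods.HyperbolicBloch.ZagierDilogarithm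

end
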